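import Literature.AlgebraicGeometry.HodgeTheory.ChernCharacterBetti
import Literature.AlgebraicGeometry.HodgeTheory.MixedEllipticCurvesProductsHodgeClasses
import Literature.AlgebraicGeometry.HodgeTheory.AbelianVarietyMultiplicationPullback
import Literature.AlgebraicGeometry.HodgeTheory.AbelianVarietyEndomorphismsHOne
import Literature.AlgebraicGeometry.KTheory.GrothendieckGroup
import Literature.AlgebraicGeometry.Modules.VectorBundleFiniteLocallyFree
import HarnessLib

/-!
# Chern characters of finite direct sums, of pull-backs along `[m]`, and rational K-combinations (bookkeeping)

Layer `Literature/AlgebraicGeometry/HodgeTheory`. PROOFS ONLY (no definition, no named fact): the K-theoretic bookkeeping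
that turns the per-degree SPAN property of a Chern character theory `C : ChernCharacterBetti`
(`algebraicClasses_le_span_ch`) into statements about ONE finite locally free module, as used by the «seed» existence
statements of the Weil programme (finite locally free modules with a prescribed Chern character modulo `ℚ[h]`).

* §1 `isFiniteLocallyFree_foldr_biprod`, `ChernCharacterBetti.ch_foldr_biprod`: a list-indexed direct sum
  `E₁ ⊞ (E₂ ⊞ (⋯ ⊞ Z))` (`List.foldr (· ⊞ ·) Z l`, a TERM, no definition) of finite locally free modules is finite locally
  free and `ch_i` is additive on it (Whitney, `ch_biprod`).
* §2 `ChernCharacterBetti.ch_pullback_nsmul_id`: on a complex abelian variety `P`, `ch_i([m]^*E) = m^{2i}·ch_i(E)`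
  (`map_ch` and the tree's `[m]^* = mᵏ` on `Hᵏ(P(ℂ); ℂ)`, `complexBetti_map_nsmul_id_apply`).
* §3 `exists_rat_combination_of_mem_span`, `ChernCharacterBetti.exists_rat_combination_of_mem_algebraicClasses`:
  a RATIONAL class in the `ℂ`-span of a SET of rational classes is a RATIONAL combination of finitely many of them
  (the tree's `exists_rat_coords_of_isRationalClass_of_linearIndependent` on a basis extracted from the set); hence a rational algebraic class on a smooth projective `X` is
  `Σ qₖ·ch_p(Eₖ)` for finitely many vector bundles `Eₖ` and `qₖ ∈ ℚ`.
(The purifying Vandermonde coefficients and the list bookkeeping of the consumer live with the consumer, Summits side.)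

References: [Fulton1998] Example 3.2.3, §15.1 (ii); [MumfordAV1970] §1 (3) (`[m]^*` on cohomology); [HatcherAT2002] §3.1.
-/

noncomputable section

open CategoryTheory CategoryTheory.Limits AlgebraicGeometry

namespace Literature.AlgebraicGeometry.HodgeTheory

open Literature.AlgebraicTopology.SingularHomology Literature.AlgebraicGeometry.Motives
open Literature.AlgebraicGeometry.KTheory

/-! ## §1 List-indexed direct sums -/

section Sums

variable {X : Motives.SchemeOver ℂ}

/-- A list-indexed direct sum `E₁ ⊞ (E₂ ⊞ (⋯ ⊞ Z))` of finite locally free modules is finite locally free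
(`KZero.isFiniteLocallyFree_biprod`, by induction on the list). [cite: Hartshorne1977, II Ex. 5.7 (b)] -/
theorem isFiniteLocallyFree_foldr_biprod {Z : X.left.Modules} (hZ : IsFiniteLocallyFree Z) :
    ∀ (l : List X.left.Modules), (∀ E ∈ l, IsFiniteLocallyFree E) →
      IsFiniteLocallyFree (l.foldr (· ⊞ ·) Z)
  | [], _ => hZ
  | E :: l, h => by
    rw [List.foldr_cons]
    exact KZero.isFiniteLocallyFree_biprod (h E List.mem_cons_self)
      (isFiniteLocallyFree_foldr_biprod hZ l fun F hF ↦ h F (List.mem_cons_of_mem E hF))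

/-- **Whitney on a list-indexed direct sum**: `chᵢ(E₁ ⊞ (E₂ ⊞ (⋯ ⊞ Z))) = Σₖ chᵢ(Eₖ) + chᵢ(Z)` for finite locally
free `Eₖ`, `Z` (`ch_biprod`, by induction on the list). [cite: Fulton1998, Example 3.2.3] -/
theorem ChernCharacterBetti.ch_foldr_biprod (C : ChernCharacterBetti) {Z : X.left.Modules} (hZ : IsFiniteLocallyFree Z)
    (i : ℕ) : ∀ (l : List X.left.Modules), (∀ E ∈ l, IsFiniteLocallyFree E) →
      C.ch X (l.foldr (· ⊞ ·) Z) i = (l.map fun E ↦ C.ch X E i).sum + C.ch X Z i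
  | [], _ => by rw [List.foldr_nil, List.map_nil, List.sum_nil, zero_add]
  | E :: l, h => by
    have hl : ∀ F ∈ l, IsFiniteLocallyFree F := fun F hF ↦ h F (List.mem_cons_of_mem E hF)
    rw [List.foldr_cons, C.ch_biprod E _ (h E List.mem_cons_self).isVectorBundle
      (isFiniteLocallyFree_foldr_biprod hZ l hl).isVectorBundle, ChernCharacterBetti.ch_foldr_biprod C hZ i l hl,
      List.map_cons, List.sum_cons, add_assoc]

end Sums

/-! ## §2 Pull-back along multiplication by `m` on an abelian variety -/

section Mult

/-- **`chᵢ([m]^*E) = m^{2i}·chᵢ(E)`** on a complex abelian variety `P`: functoriality `ch ∘ [m]^* = [m]^* ∘ ch` and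
`[m]^* = mᵏ` on `Hᵏ(P(ℂ); ℂ)` (`complexBetti_map_nsmul_id_apply`). [cite: Fulton1998, §15.1 (ii)]
[cite: MumfordAV1970, §1 (3)] -/
theorem ChernCharacterBetti.ch_pullback_nsmul_id (C : ChernCharacterBetti) (P : AbelianVariety ℂ) (m : ℕ)
    (E : P.X.left.Modules) (hE : IsVectorBundle E) (i : ℕ) :
    C.ch P.X ((Scheme.Modules.pullback (m • 𝟙 P).hom.hom.hom.left).obj E) i = ((m : ℂ) ^ (2 * i)) • C.ch P.X E i := by
  rw [← C.map_ch (m • 𝟙 P).hom.hom.hom E hE i, complexBetti_map_nsmul_id_apply P m (2 * i)]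

end Mult

/-! ## §3 Rational classes in a `ℂ`-span of rational classes are rational combinations -/

section RationalSpan

variable {Y : Type} [TopologicalSpace Y] {k : ℕ}

/-- **A rational class in the `ℂ`-span of a SET of rational classes is a rational combination of finitely many of them**
(extract a `ℂ`-basis of the span from the set, `exists_linearIndependent`, finite since the ambient space is
finite-dimensional, and apply the tree's `exists_rat_coords_of_isRationalClass_of_linearIndependent`). [cite: HatcherAT2002, §3.1] -/
theorem exists_rat_combination_of_mem_span [Module.Finite ℂ (singularCohomology ℂ ℂ Y k)]
    {S : Set (singularCohomology ℂ ℂ Y k)} (hS : ∀ c ∈ S, IsRationalClass c)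
    {r : singularCohomology ℂ ℂ Y k} (hr : IsRationalClass r) (hmem : r ∈ Submodule.span ℂ S) :
    ∃ (ι : Type) (_ : Fintype ι) (v : ι → singularCohomology ℂ ℂ Y k) (q : ι → ℚ),
      (∀ i, v i ∈ S) ∧ r = ∑ i, ((q i : ℚ) : ℂ) • v i := by
  classical
  obtain ⟨b, hbS, hbspan, hbi⟩ := exists_linearIndependent ℂ S
  have hbfin : b.Finite := hbi.finite
  haveI : Fintype b := hbfin.fintype
  have hmem' : r ∈ Submodule.span ℂ (Set.range ((↑) : b → singularCohomology ℂ ℂ Y k)) := by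
    rwa [Subtype.range_coe, hbspan]
  obtain ⟨q, hq⟩ := exists_rat_coords_of_isRationalClass_of_linearIndependent
    (v := ((↑) : b → singularCohomology ℂ ℂ Y k)) (fun c ↦ hS c.1 (hbS c.2)) hbi hr hmem'
  exact ⟨b, inferInstance, (↑), q, fun c ↦ hbS c.2, hq⟩

/-- **A rational algebraic class is a rational K-combination of Chern characters**: on a smooth projective `X` with
`H²ᵖ(X(ℂ); ℂ)` finite-dimensional, a RATIONAL class in `algebraicClasses X p` is `Σₖ qₖ·ch_p(Eₖ)` for finitely many vector
bundles `Eₖ` and RATIONAL `qₖ` (SPAN `algebraicClasses_le_span_ch` + rational descent). [cite: Fulton1998, Example 15.2.16 (b)]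
[cite: Deligne2000, §2 Remark (ii)] -/
theorem ChernCharacterBetti.exists_rat_combination_of_mem_algebraicClasses (C : ChernCharacterBetti) {n : ℕ}
    {X : Motives.SchemeOver ℂ} (hX : Motives.IsSmoothProjective n X) (p : ℕ)
    [Module.Finite ℂ (complexBetti X (2 * p))] {w : complexBetti X (2 * p)} (hwQ : IsRationalClass w)
    (hwA : w ∈ algebraicClasses X p) :
    ∃ (ι : Type) (_ : Fintype ι) (E : ι → X.left.Modules) (q : ι → ℚ),
      (∀ i, IsVectorBundle (E i)) ∧ ∑ i, ((q i : ℚ) : ℂ) • C.ch X (E i) p = w := by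
  classical
  have hmem := C.algebraicClasses_le_span_ch hX p hwA
  obtain ⟨ι, _, v, q, hvS, hr⟩ := exists_rat_combination_of_mem_span
    (S := {c | ∃ E : X.left.Modules, Motives.IsVectorBundle E ∧ C.ch X E p = c})
    (by rintro _ ⟨E, hE, rfl⟩; exact C.isRationalClass_ch X E hE p) hwQ hmem
  choose E hE hEc using hvS
  refine ⟨ι, inferInstance, E, q, hE, ?_⟩
  rw [hr]
  exact Finset.sum_congr rfl fun i _ ↦ by rw [hEc]

end RationalSpan


end Literature.AlgebraicGeometry.HodgeTheory

end
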